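import Summits.QuantumFields.YangMills.Theorems.BalabanUVNodesN15KingModelTwoPointThermodynamicLimit
import Literature.Analysis.SpecialFunctions.GammaVerticalBounds
import Mathlib.Analysis.Complex.RemovableSingularity

/-!
# BalabanUVNodes ∕ N15 — THE KING-MODEL RUNG (PART Ϸ-a): THE COMPLEX BLOCK FORM FACTOR `|u⁰|²(w) = 2(1 − cos w)∕w²` IS ENTIRE, AND THE ONE-LINE
# BLOCK PROPAGATOR `w ↦ |u⁰|²(w)∕(w² + M²)` IS HOLOMORPHIC IN THE STRIP `|Im w| < M` WITH THE BOUND `2(1 + cosh Im w)∕(|w|²(Re²w − Im²w + M²))`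
# (toward the OPTIMAL exponential decay rate of the continuum two-point function `S₂^{ℝ}` of part Ϝ-j by a Paley–Wiener shift of the momentum contour)
# (Track A, DAG node N15 = NE2; FAN-OUT v1.1 §N15 s3 «KING-MODEL RUNG»; uses part Ϝ-j's `Real.sinc` form of `|u⁰|²` and Mathlib's removable-singularity theorem;
# count-neutral)

HONEST FRAMING.  Count-neutral (cell `pub-ymgap`, seat `pub-ymgap-dag-n15-e` g34; `--supports stmt-QuantumFields-27366 --as helper` = K3⁸
`SpineGivenEndpointR13SepCoPHV`).  King's `A = 0`, `g = 0` model ([King1986] C. King, Commun. Math. Phys. **102** (1986) 649–677): part Ϝ-j wrote the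
thermodynamic limit of the block-smeared Schwinger two-point function as `S₂^{ℝ}(z) = (2π)^{−n}∫|u⁰(p)|²cos(p·z)∕(|p|²+m²)dp` with the block form factor
`|u⁰(p)|² = Π_ν sinc²(p_ν∕2)` ((4.3)∕(4.36) at `η = 0`), and part Ϝ-k proved the exponential clustering `|S₂^{ℝ}(z)| ≤ (2∕γ_m)e^{−κ_M|z_ν|}` with the
Combes–Thomas rate `κ_M < m` inherited from the lattice.  The OPTIMAL statement — decay at EVERY rate `c < m`, `m` the mass (Thm 3.3 (3.6)'s shape with the
true correlation length) — follows by shifting the `p_ν`-contour to `Im p_ν = ±c` (Paley–Wiener; the tree's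
`Literature.Analysis.Quadrature.norm_fourier_le_exp_mul_integral`), which needs the one-line integrand as a HOLOMORPHIC function of `p_ν` in a strip.  This
file supplies that complex-analytic input: the entire extension `sincSqC` of `x ↦ sinc²(x∕2) = 2(1 − cos x)∕x²` (Mathlib's removable-singularity theorem at
`0`, where `|1 − cos w| ≤ |w|²`), its growth bound `|sincSqC w| ≤ 2(1 + cosh(Im w))∕|w|²` (`|cos w| ≤ cosh(Im w)`), and the one-line block propagator
`propLine M² w = sincSqC w∕(w² + M²)`: holomorphic where `|Im w|² < M²` (the poles `±iM` lie outside), with an explicit bound.  Parts Ϸ-b∕Ϸ-c do the shift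
and the `n`-dimensional assembly.  NOT a node discharge (N15 is booked through n15-a's knit, untouched here); nothing Bałaban ∕ continuum-Yang–Mills ∕ `ℝ⁴` ∕
OS ∕ mass-gap-of-Yang–Mills ∕ Clay (the «mass» here is the free field's `m`).  0 `sorry`; TWO plumbing defs (`sincSqC`, `propLine`); standard axioms.

WHAT THIS FILE PROVES (kernel).  §1 (`|cos w| ≤ cosh(Im w)` is REUSED: `Literature…GammaVert.norm_cos_le_cosh_im`) `norm_one_sub_cos_le` (`≤ 1 + cosh(Im w)`), `norm_one_sub_cos_le_sq` (private;
`≤ |w|²` for `|w| ≤ 1`); §2 `sincSqC`, `sincSqC_eq_of_ne_zero`, ★ `sincSqC_ofReal` (`= sinc²(x∕2)` for real `x ≠ 0`), ★ `norm_sincSqC_le`, ★★ **`differentiable_sincSqC`**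
(ENTIRE), `continuous_sincSqC`; §3 `propLine`, `sq_add_ne_zero_of_im_sq_lt` (no zero of `w² + M²` in the strip), `re_sq_sub_im_sq_add_le_norm`,
★★ `differentiableOn_propLine` (holomorphic on `{|Im w| < a}`, `a² ≤ M²`), ★ `norm_propLine_le`, `propLine_ofReal` (the real integrand `sinc²(x∕2)∕(x²+M²)`).

HONEST SCOPE.  Elementary complex analysis; folklore.  N15 untouched; counts unmoved.  Locators (use): [King1986] (4.3) p.670, (4.36) p.674, Thm 3.3 (3.6) p.655.
-/

noncomputable section

open scoped BigOperators Topology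
open Complex Filter MeasureTheory

namespace Summit.QuantumFields.YangMills.BalabanUVNodes.N15KingModelRung.OptimalDecay

open Literature.Analysis.SpecialFunctions.GammaVert (norm_cos_le_cosh_im)

/-! ## §1 Elementary bounds for the complex cosine (`|cos w| ≤ cosh(Im w)` is the tree's `GammaVert.norm_cos_le_cosh_im`) -/

/-- `|1 − cos w| ≤ 1 + cosh(Im w)`. [folklore] -/
theorem norm_one_sub_cos_le (w : ℂ) : ‖1 - Complex.cos w‖ ≤ 1 + Real.cosh w.im :=
  (norm_sub_le _ _).trans (by rw [norm_one]; linarith [norm_cos_le_cosh_im w])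

/-- Near the origin: `|1 − cos w| ≤ |w|²` for `|w| ≤ 1` (`2(1 − cos w) = −[(e^{iw}−1−iw) + (e^{−iw}−1+iw)]` and Mathlib's `‖e^x − 1 − x‖ ≤ ‖x‖²`; private copy —
the same letter exists in `Summits/QuantumFields/BalabanUV/Beta/EriceZetaLocalizedHessianRayWitness`, not an importable venue for this rung). [folklore] -/
private theorem norm_one_sub_cos_le_sq {w : ℂ} (hw : ‖w‖ ≤ 1) : ‖1 - Complex.cos w‖ ≤ ‖w‖ ^ 2 := by
  have h : 1 - Complex.cos w = -((cexp (w * I) - 1 - w * I) + (cexp (-w * I) - 1 - (-w * I))) / 2 := by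
    have h2 := Complex.two_cos w
    have : Complex.cos w = (cexp (w * I) + cexp (-w * I)) / 2 := by rw [← h2]; ring
    rw [this]; ring
  have h1 : ‖w * I‖ ≤ 1 := by rw [norm_mul, Complex.norm_I, mul_one]; exact hw
  have h2 : ‖-w * I‖ ≤ 1 := by rw [norm_mul, norm_neg, Complex.norm_I, mul_one]; exact hw
  have e1 := Complex.norm_exp_sub_one_sub_id_le h1
  have e2 := Complex.norm_exp_sub_one_sub_id_le h2
  rw [norm_mul, Complex.norm_I, mul_one] at e1
  rw [norm_mul, norm_neg, Complex.norm_I, mul_one] at e2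
  rw [h, norm_div, norm_neg, Complex.norm_two]
  have := norm_add_le (cexp (w * I) - 1 - w * I) (cexp (-w * I) - 1 - (-w * I))
  linarith

/-! ## §2 The entire extension of `x ↦ sinc²(x∕2) = 2(1 − cos x)∕x²` -/

/-- The raw form factor `2(1 − cos w)∕w²` (junk value at `w = 0`). [cite: King1986, (4.3) p.670] -/
def sincSqRaw (w : ℂ) : ℂ := 2 * (1 - Complex.cos w) / w ^ 2

/-- ★ **THE COMPLEX BLOCK FORM FACTOR** `|u⁰|²(w)`: the entire extension of `2(1 − cos w)∕w²`, the singularity at `0` removed (value = the limit).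
[cite: King1986, (4.3) p.670, (4.36) p.674] -/
def sincSqC : ℂ → ℂ := Function.update sincSqRaw 0 (limUnder (𝓝[≠] (0 : ℂ)) sincSqRaw)

/-- Away from `0`: `sincSqC w = 2(1 − cos w)∕w²`. [cite: King1986, (4.3) p.670] -/
theorem sincSqC_eq_of_ne_zero {w : ℂ} (hw : w ≠ 0) : sincSqC w = 2 * (1 - Complex.cos w) / w ^ 2 := by
  unfold sincSqC
  rw [Function.update_of_ne hw]
  rfl

/-- ★ **On the real line it is King's `|u⁰(x)|² = sinc²(x∕2)`** (`x ≠ 0`; `2(1 − cos x) = 4sin²(x∕2)`). [cite: King1986, (4.3) p.670, (4.36) p.674] -/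
theorem sincSqC_ofReal {x : ℝ} (hx : x ≠ 0) : sincSqC (x : ℂ) = ((Real.sinc (x / 2) ^ 2 : ℝ) : ℂ) := by
  rw [sincSqC_eq_of_ne_zero (ofReal_ne_zero.mpr hx), Real.sinc_of_ne_zero (div_ne_zero hx two_ne_zero)]
  have hs : Real.sin (x / 2) ^ 2 = (1 - Real.cos x) / 2 := by
    rw [Real.sin_sq_eq_half_sub, show 2 * (x / 2) = x by ring]; ring
  have hr : (Real.sin (x / 2) / (x / 2)) ^ 2 = 2 * (1 - Real.cos x) / x ^ 2 := by
    rw [div_pow, hs]; field_simp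
  rw [hr]
  push_cast
  ring

/-- ★ **Growth**: `|sincSqC w| ≤ 2(1 + cosh(Im w))∕|w|²` for `w ≠ 0`. [folklore] -/
theorem norm_sincSqC_le {w : ℂ} (hw : w ≠ 0) : ‖sincSqC w‖ ≤ 2 * (1 + Real.cosh w.im) / ‖w‖ ^ 2 := by
  rw [sincSqC_eq_of_ne_zero hw, norm_div, norm_mul, Complex.norm_two, norm_pow]
  exact div_le_div_of_nonneg_right (mul_le_mul_of_nonneg_left (norm_one_sub_cos_le w) zero_le_two) (by positivity)

/-- The raw function is bounded by `2` on the punctured unit disc. [folklore] -/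
theorem norm_sincSqRaw_le_two {w : ℂ} (hw : w ≠ 0) (h1 : ‖w‖ ≤ 1) : ‖sincSqRaw w‖ ≤ 2 := by
  unfold sincSqRaw
  rw [norm_div, norm_mul, Complex.norm_two, norm_pow]
  have hpos : 0 < ‖w‖ ^ 2 := by positivity
  rw [div_le_iff₀ hpos]
  nlinarith [norm_one_sub_cos_le_sq h1]

/-- The raw function is holomorphic away from `0`. [folklore] -/
theorem differentiableAt_sincSqRaw {w : ℂ} (hw : w ≠ 0) : DifferentiableAt ℂ sincSqRaw w := by
  unfold sincSqRaw
  exact (((differentiableAt_const _).sub Complex.differentiableAt_cos).const_mul _).div (differentiableAt_pow 2) (pow_ne_zero 2 hw)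

/-- ★★ **`sincSqC` IS ENTIRE** (removable singularity at `0`: bounded by `2` on the punctured unit disc). [folklore] -/
theorem differentiable_sincSqC : Differentiable ℂ sincSqC := by
  have hball : DifferentiableOn ℂ sincSqC (Metric.ball (0 : ℂ) 1) := by
    unfold sincSqC
    refine Complex.differentiableOn_update_limUnder_of_bddAbove (Metric.ball_mem_nhds 0 one_pos) ?_ ?_
    · intro w hw
      exact (differentiableAt_sincSqRaw (fun h => hw.2 h)).differentiableWithinAt
    · refine ⟨2, ?_⟩
      rintro _ ⟨w, hw, rfl⟩
      have h1 : ‖w‖ ≤ 1 := by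
        have := hw.1
        rw [Metric.mem_ball, dist_zero_right] at this
        exact this.le
      exact norm_sincSqRaw_le_two (fun h => hw.2 h) h1
  intro w
  by_cases h : ‖w‖ < 1
  · exact hball.differentiableAt (Metric.isOpen_ball.mem_nhds (by rwa [Metric.mem_ball, dist_zero_right]))
  · have hw : w ≠ 0 := by
      rintro rfl
      exact h (by simp)
    have heq : sincSqC =ᶠ[𝓝 w] sincSqRaw := by
      filter_upwards [isOpen_compl_singleton.mem_nhds hw] with v hv
      exact Function.update_of_ne hv _ _
    exact heq.differentiableAt_iff.mpr (differentiableAt_sincSqRaw hw)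

/-- `sincSqC` is continuous. [folklore] -/
theorem continuous_sincSqC : Continuous sincSqC := differentiable_sincSqC.continuous

/-! ## §3 The one-line block propagator `w ↦ |u⁰|²(w)∕(w² + M²)` -/

/-- The one-line block propagator `propLine M² w = sincSqC w∕(w² + M²)` (`M² = m² + |p_⊥|²` in part Ϸ-c). [cite: King1986, (4.3) p.670, (4.38) p.675] -/
def propLine (M2 : ℝ) (w : ℂ) : ℂ := sincSqC w / (w ^ 2 + (M2 : ℂ))

/-- The denominator does not vanish in the strip: `Im²w < M²` ⇒ `w² + M² ≠ 0` (`M² > 0`; the zeros are `±iM`). [folklore] -/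
theorem sq_add_ne_zero_of_im_sq_lt {M2 : ℝ} (hM : 0 < M2) {w : ℂ} (hw : w.im ^ 2 < M2) : w ^ 2 + (M2 : ℂ) ≠ 0 := by
  intro h
  have hre := congrArg Complex.re h
  have him := congrArg Complex.im h
  simp only [add_re, ofReal_re, zero_re, add_im, ofReal_im, add_zero, zero_im, sq, mul_re, mul_im] at hre him
  have h2 : w.re * w.im = 0 := by linarith
  rcases mul_eq_zero.mp h2 with h0 | h0
  · rw [h0] at hre
    nlinarith
  · rw [h0] at hre
    nlinarith [sq_nonneg w.re]

/-- `Re²w − Im²w + M² ≤ |w² + M²|` (the real part is at most the norm). [folklore] -/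
theorem re_sq_sub_im_sq_add_le_norm (M2 : ℝ) (w : ℂ) : w.re ^ 2 - w.im ^ 2 + M2 ≤ ‖w ^ 2 + (M2 : ℂ)‖ := by
  have h := Complex.re_le_norm (w ^ 2 + (M2 : ℂ))
  have e : (w ^ 2 + (M2 : ℂ)).re = w.re ^ 2 - w.im ^ 2 + M2 := by
    simp only [add_re, ofReal_re, sq, mul_re]
  rwa [e] at h

/-- ★★ **HOLOMORPHY IN THE STRIP**: `propLine M²` is holomorphic on `{|Im w| < a}` whenever `a² ≤ M²` (`M² > 0`). [folklore] -/
theorem differentiableOn_propLine {M2 : ℝ} (hM : 0 < M2) {a : ℝ} (ha : a ^ 2 ≤ M2) :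
    DifferentiableOn ℂ (propLine M2) {w : ℂ | |w.im| < a} := by
  intro w hw
  have him : w.im ^ 2 < M2 := by
    have h1 : |w.im| < a := hw
    have h0 : 0 ≤ |w.im| := abs_nonneg _
    have h2 : w.im ^ 2 < a ^ 2 := by
      rw [← sq_abs]
      exact pow_lt_pow_left₀ h1 h0 two_ne_zero
    exact lt_of_lt_of_le h2 ha
  exact ((differentiable_sincSqC w).div (((differentiableAt_pow 2).add_const _)) (sq_add_ne_zero_of_im_sq_lt hM him)).differentiableWithinAt

/-- ★ **THE BOUND ON A LINE**: for `w ≠ 0` with `Im²w < Re²w + M²`, `|propLine M² w| ≤ 2(1 + cosh Im w)∕(|w|²·(Re²w − Im²w + M²))`. [folklore] -/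
theorem norm_propLine_le {M2 : ℝ} {w : ℂ} (hw : w ≠ 0) (h : w.im ^ 2 < w.re ^ 2 + M2) :
    ‖propLine M2 w‖ ≤ 2 * (1 + Real.cosh w.im) / (‖w‖ ^ 2 * (w.re ^ 2 - w.im ^ 2 + M2)) := by
  have hD : 0 < w.re ^ 2 - w.im ^ 2 + M2 := by linarith
  have hw2 : 0 < ‖w‖ ^ 2 := by positivity
  unfold propLine
  rw [norm_div]
  have hden : w.re ^ 2 - w.im ^ 2 + M2 ≤ ‖w ^ 2 + (M2 : ℂ)‖ := re_sq_sub_im_sq_add_le_norm M2 w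
  have hden' : 0 < ‖w ^ 2 + (M2 : ℂ)‖ := lt_of_lt_of_le hD hden
  calc ‖sincSqC w‖ / ‖w ^ 2 + (M2 : ℂ)‖ ≤ (2 * (1 + Real.cosh w.im) / ‖w‖ ^ 2) / (w.re ^ 2 - w.im ^ 2 + M2) :=
        div_le_div₀ (by positivity) (norm_sincSqC_le hw) hD hden
    _ = 2 * (1 + Real.cosh w.im) / (‖w‖ ^ 2 * (w.re ^ 2 - w.im ^ 2 + M2)) := by rw [div_div]

/-- ★ **On the real line it is King's one-line integrand** `sinc²(x∕2)∕(x² + M²)` (`x ≠ 0`). [cite: King1986, (4.3) p.670, (4.38) p.675] -/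
theorem propLine_ofReal {M2 : ℝ} {x : ℝ} (hx : x ≠ 0) : propLine M2 (x : ℂ) = ((Real.sinc (x / 2) ^ 2 / (x ^ 2 + M2) : ℝ) : ℂ) := by
  unfold propLine
  rw [sincSqC_ofReal hx]
  push_cast
  rfl

/-- Its norm on the real line: `|propLine M² x| = sinc²(x∕2)∕(x² + M²)` (`x ≠ 0`, `M² ≥ 0`). [folklore] -/
theorem norm_propLine_ofReal {M2 : ℝ} (hM : 0 ≤ M2) {x : ℝ} (hx : x ≠ 0) : ‖propLine M2 (x : ℂ)‖ = Real.sinc (x / 2) ^ 2 / (x ^ 2 + M2) := by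
  rw [propLine_ofReal hx, Complex.norm_real, Real.norm_eq_abs, abs_of_nonneg (by positivity)]

end Summit.QuantumFields.YangMills.BalabanUVNodes.N15KingModelRung.OptimalDecay
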